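import Summits.ValiantsHypothesis.ValiantsHypothesis.Theorems.KPlusLogSqLawTropicalBStaircaseDesign
import Summits.ValiantsHypothesis.ValiantsHypothesis.Theorems.KPlusLogSqLawTropicalBSmallFormats

/-!
# Route `KPlusLogSqLaw`, crux `TropicalB` — the `K = 4` exponent FORK as one kernel statement; no uniform exponent law

HONEST FRAMING.  Helper file (bookkeeping of landed calibration theorems) toward the registered stubs `stub_tropThin` /
`stub_tropFat` of `Cruxes/TropicalB/Lines/birth.lean` (crux `TropicalB`, ledger item `stmt-ValiantsHypothesis-19771`, route
`KPlusLogSqLaw`, DRAFT; cell `pub-symmetroid`, seat `val-sym-trop-p1`, 2026-08-26).  Nothing here proves any part of a stub;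
nothing asserts `TropicalB`, `KPlusLogSqLaw`, `MatrixDescartes`, `TropK4Law 2` or anything about `VP ≠ VNP`.

* `not_tropExponentLawSome : ¬ TropExponentLawSome` — no exponent `e` at all makes `T(m,K) ≤ 2^{CK}·m^e` true
  (from `WalkDesign.not_tropExponentLaw`);
* `tropK4Law_mono` — `TropK4Law e` is monotone in `e`; `not_tropK4Law_of_le_one` (from `WalkDesign.not_tropK4Law_one`),
  `tropK4Law_of_three_le` (from `tropK4Law_three` of `…TropicalBSmallFormats`);
* `not_tropColumnLaw` — for `2e + 2 ≤ K` the column `K` is not `O((m+1)^e)` (column exponents are `≥ (K−1)/2`);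
* **`tropK4Law_fork`** — the cell's `K = 4` question (D2) as ONE kernel statement: the set of exponents `e` with
  `TropK4Law e` is EITHER `{e | 2 ≤ e}` OR `{e | 3 ≤ e}` (classical case split on the open `TropK4Law 2`; the theorem does
  not say which).
All [folklore].
-/

set_option linter.dupNamespace false
set_option autoImplicit false

namespace Summit.ValiantsHypothesis.ValiantsHypothesis.Theorems.KPlusLogSqLaw

open Summit.ValiantsHypothesis.ValiantsHypothesis.Theorems.LacunarySymmetroidMatrixDescartes.TropicalCensus

/-- **No uniform exponent law**: `¬ TropExponentLawSome`. [folklore, from `WalkDesign.not_tropExponentLaw`] -/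
theorem not_tropExponentLawSome : ¬ TropExponentLawSome :=
  fun ⟨e, h⟩ => WalkDesign.not_tropExponentLaw e h

/-- `TropK4Law` is monotone in the exponent. [folklore] -/
theorem tropK4Law_mono {e e' : ℕ} (hee' : e ≤ e') (h : TropK4Law e) : TropK4Law e' := by
  obtain ⟨C, hC⟩ := h
  refine ⟨C, fun m => tropRootLawAt_mono ?_ (hC m)⟩
  exact Nat.mul_le_mul_left _ (Nat.pow_le_pow_right (Nat.succ_pos m) hee')

/-- exponents `≤ 1` fail at `K = 4`. [folklore, from `WalkDesign.not_tropK4Law_one`] -/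
theorem not_tropK4Law_of_le_one {e : ℕ} (he : e ≤ 1) : ¬ TropK4Law e :=
  fun h => WalkDesign.not_tropK4Law_one (tropK4Law_mono he h)

/-- exponents `≥ 3` hold at `K = 4`. [folklore, from `tropK4Law_three`] -/
theorem tropK4Law_of_three_le {e : ℕ} (he : 3 ≤ e) : TropK4Law e :=
  tropK4Law_mono he tropK4Law_three

/-- **Column exponents are at least `(K − 1)/2`.**  For `2e + 2 ≤ K` no bound `T(m,K) ≤ C·(m+1)^e` holds for all `m`:
the staircase with `L = K − 1` levels has `n^{K−1} − 1` breakpoints on `≤ 2^{2K}·n²` nodes.  (`K = 4`, `e = 1` is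
`WalkDesign.not_tropK4Law_one`.) [folklore, from `WalkDesign.staircase_lower`] -/
theorem not_tropColumnLaw (K e C : ℕ) (hK : 2 * e + 2 ≤ K) : ∃ m, ¬ TropRootLawAt m K (C * (m + 1) ^ e) := by
  by_contra hall
  simp only [not_exists, not_not] at hall
  obtain ⟨L, rfl⟩ : ∃ L, K = L + 1 := ⟨K - 1, by omega⟩
  set A := C * (2 ^ (2 * L + 3)) ^ e with hA
  set n := 2 * A + 2 with hn
  have hn2 : 2 ≤ n := by omega
  have hne : Even n := ⟨A + 1, by omega⟩
  set m := ((2 ^ L - 1) * (n + 1) + 1) * (2 ^ L * n * 2) with hm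
  have h1 := WalkDesign.staircase_lower n L hn2 hne (by omega) _ (hall m)
  have hm' : m ≤ 2 ^ (2 * L + 2) * n ^ 2 := WalkDesign.staircase_format_le n L (by omega)
  -- `C·(m+1)^e ≤ A·n^{2e}`
  have hm1 : m + 1 ≤ 2 ^ (2 * L + 3) * n ^ 2 := by
    have h7 : 1 ≤ n ^ 2 := Nat.one_le_pow _ _ (by omega)
    have h8 : 2 ^ (2 * L + 3) = 2 * 2 ^ (2 * L + 2) := by ring
    have h9 : 1 ≤ 2 ^ (2 * L + 2) := Nat.one_le_two_pow
    have h10 := Nat.mul_le_mul h9 h7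
    rw [h8]
    linarith
  have h2 : C * (m + 1) ^ e ≤ A * n ^ (2 * e) := by
    calc C * (m + 1) ^ e ≤ C * (2 ^ (2 * L + 3) * n ^ 2) ^ e := Nat.mul_le_mul_left _ (Nat.pow_le_pow_left hm1 e)
      _ = A * n ^ (2 * e) := by rw [hA, mul_pow, ← pow_mul]; ring
  -- `n^L ≥ n^{2e}·n`
  have h3 : n ^ (2 * e) * n ≤ n ^ L := by
    rw [← pow_succ]
    exact Nat.pow_le_pow_right (by omega) (by omega)
  have h4 : 1 ≤ n ^ (2 * e) := Nat.one_le_pow _ _ (by omega)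
  have h5 : n ^ L - 1 ≤ A * n ^ (2 * e) := h1.trans h2
  have : n ^ (2 * e) * n ≤ A * n ^ (2 * e) + 1 := by omega
  nlinarith

/-- **The `K = 4` fork.**  The exponents `e` for which the `K = 4` column of the tropical census is `O((m+1)^e)` form
either the up-set `{e | 2 ≤ e}` or the up-set `{e | 3 ≤ e}` — according as the OPEN `TropK4Law 2` holds or fails; the
theorem decides nothing about which. [folklore] -/
theorem tropK4Law_fork : (∀ e, TropK4Law e ↔ 2 ≤ e) ∨ (∀ e, TropK4Law e ↔ 3 ≤ e) := by
  by_cases h2 : TropK4Law 2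
  · left
    intro e
    constructor
    · intro h
      by_contra hlt
      exact not_tropK4Law_of_le_one (by omega) h
    · intro he
      exact tropK4Law_mono he h2
  · right
    intro e
    constructor
    · intro h
      by_contra hlt
      rcases Nat.lt_or_ge e 2 with h1 | h1
      · exact not_tropK4Law_of_le_one (by omega) h
      · exact h2 (by
          have : e = 2 := by omega
          subst this
          exact h)
    · intro he
      exact tropK4Law_of_three_le he

end Summit.ValiantsHypothesis.ValiantsHypothesis.Theorems.KPlusLogSqLaw
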